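import Literature.Analysis.FluidPDE.PassiveVectorGalerkin
import HarnessLib

/-!
# The Fourier–Galerkin scheme for the passive solenoidal vector: energy identity and decay of invariant blocks

Analysis/FluidPDE proof-support file (theorems only; no definitions, no named facts), supplement to
`PassiveVectorGalerkin` (§ energy). The Galerkin transport term is a convolution with the finitely many carrier
modes (Constantin–Foias 1988, (8.5)): mode `k` is fed only by the modes `k - l`, `β l ≠ 0`. Hence every
frequency block `F ⊆ S` which is symmetric and CLOSED under the active couplings (whenever `l + m = k ∈ F`,
`β l ≠ 0` and `c m ≠ 0`, then `m ∈ F`) carries its own energy identity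
`∑_{k∈F} Re⟪c k, V(c) k⟫ = -κ ∑_{k∈F} 4π²|k|²‖c k‖²` (the transport term is antisymmetric on the block: it is
the transport term of the restricted — still real and divergence-free — field), and along a Galerkin solution the
block energy `E_F(t) = ∑_{k∈F} ‖α(t) k‖²` is non-increasing and decays like `e^{-8π²κR²(t-t₀)}` when `|k|² ≥ R²`
on the modes of `F` where `α` does not vanish (Robinson–Rodrigo–Sadowski 2016, (4.6)–(4.8), block by block).
For the lattice-word cell carriers of crux K2R `RealisedQuasiStaticCellLaw` (cell `ad-ideate`, STUB-PLAN
`stub_lowSectorDecay` §1/§3.5) the blocks are the cosets `k₀ + ℤ(n m_j)` of the active slot `j`, or unions of them.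

## References

* P. Constantin, C. Foias, *Navier–Stokes Equations* (Chicago 1988), Ch. 8, (8.3)–(8.5). [`ConstantinFoias1988`]
* J. C. Robinson, J. L. Rodrigo, W. Sadowski, *The three-dimensional Navier–Stokes equations* (CUP 2016),
  Thm. 4.4 Step 2, (4.6)–(4.8). [`RobinsonRodrigoSadowski2016`]
-/

open Finset Set Filter Topology
open scoped InnerProductSpace ComplexConjugate

noncomputable section

namespace Literature.Analysis.FluidPDE

namespace Torus

open FunctionSpaces.Torus FunctionSpaces

variable {d : Type*} [Fintype d]

/-! ## §1 The block energy identity -/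

section Identity

variable {S : Finset (d → ℤ)}

/-- The restriction of a transversal family to a block is transversal. [cite: ConstantinFoias1988, Ch. 8 (8.3)–(8.5)] -/
theorem isTransversal_blockRestrict {c : (d → ℤ) → EuclideanSpace ℂ d} (hcT : IsTransversal S c)
    (F : Finset (d → ℤ)) : IsTransversal S (fun k => if k ∈ F then c k else 0) := by
  intro k hk
  by_cases hkF : k ∈ F
  · simp only [if_pos hkF]; exact hcT k hk
  · simp only [if_neg hkF]; simp

/-- **On a closed block the transport term only sees the block**: if every active coupling into `k ∈ F` comes from
`F` (`l + m = k`, `β l ≠ 0`, `c m ≠ 0` ⇒ `m ∈ F`), then `convectionCoeff S β c k = convectionCoeff S β (c·1_F) k`. [cite: ConstantinFoias1988, Ch. 8 (8.5)] -/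
theorem convectionCoeff_eq_blockRestrict {β c : (d → ℤ) → EuclideanSpace ℂ d} {F : Finset (d → ℤ)}
    (hclosed : ∀ k ∈ F, ∀ l ∈ S, ∀ m ∈ S, l + m = k → β l ≠ 0 → c m ≠ 0 → m ∈ F) {k : d → ℤ} (hk : k ∈ F) :
    convectionCoeff S β c k = convectionCoeff S β (fun m => if m ∈ F then c m else 0) k := by
  rw [convectionCoeff_def, convectionCoeff_def]
  refine Finset.sum_congr rfl fun l hl => Finset.sum_congr rfl fun m hm => ?_
  split_ifs with hlm hmF
  · rfl
  · -- `m ∉ F`: the coupling is inactive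
    by_cases hβl : β l = 0
    · simp [hβl]
    · have hcm : c m = 0 := by
        by_contra hcm
        exact hmF (hclosed k hk l hl m hm hlm hβl hcm)
      rw [hcm]
  · rfl

/-- **The energy identity of a closed symmetric block** (`A = 0` Galerkin level): for conjugate-symmetric transversal
carrier and state families on a symmetric `S` and a symmetric block `F ⊆ S` closed under the active couplings,
`∑_{k∈F} Re⟪c k, V(c) k⟫ = -κ · 4π² ∑_{k∈F} |k|² ‖c k‖²` — the transport term is antisymmetric on the block. [cite: RobinsonRodrigoSadowski2016, Thm. 4.4 Step 2 (4.6)–(4.7)] -/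
theorem sum_re_inner_pvGalerkinField_block (κ : ℝ) (hS : ∀ k ∈ S, -k ∈ S)
    {β c : (d → ℤ) → EuclideanSpace ℂ d} (hβ : IsConjSymm β) (hβT : IsTransversal S β)
    (hc : IsConjSymm c) (hcT : IsTransversal S c)
    {F : Finset (d → ℤ)} (hFS : F ⊆ S) (hF : ∀ k ∈ F, -k ∈ F)
    (hclosed : ∀ k ∈ F, ∀ l ∈ S, ∀ m ∈ S, l + m = k → β l ≠ 0 → c m ≠ 0 → m ∈ F) :
    ∑ k ∈ F, (inner ℂ (c k) (pvGalerkinField κ S β c k)).re =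
      -(κ * (4 * Real.pi ^ 2 * ∑ k ∈ F, freqNormSq k * ‖c k‖ ^ 2)) := by
  classical
  set c' : (d → ℤ) → EuclideanSpace ℂ d := fun k => if k ∈ F then c k else 0 with hc'
  have hc'symm : IsConjSymm c' := hc.indicator hF
  have hc'T : IsTransversal S c' := isTransversal_blockRestrict hcT F
  -- on `F` the field of `c` is the field of `c'`
  have hV : ∀ k ∈ F, pvGalerkinField κ S β c k = pvGalerkinField κ S β c' k := by
    intro k hk
    rw [pvGalerkinField_def, pvGalerkinField_def, convectionCoeff_eq_blockRestrict hclosed hk]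
    simp only [hc', if_pos hk]
  have h1 : ∑ k ∈ F, (inner ℂ (c k) (pvGalerkinField κ S β c k)).re =
      ∑ k ∈ S, (inner ℂ (c' k) (pvGalerkinField κ S β c' k)).re := by
    rw [← Finset.sum_subset hFS (f := fun k => (inner ℂ (c' k) (pvGalerkinField κ S β c' k)).re)]
    · refine Finset.sum_congr rfl fun k hk => ?_
      rw [hV k hk]
      simp only [hc', if_pos hk]
    · intro k _ hkF
      simp only [hc', if_neg hkF, inner_zero_left, Complex.zero_re]
  have h2 : ∑ k ∈ S, freqNormSq k * ‖c' k‖ ^ 2 = ∑ k ∈ F, freqNormSq k * ‖c k‖ ^ 2 := by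
    rw [← Finset.sum_subset hFS (f := fun k => freqNormSq k * ‖c' k‖ ^ 2)]
    · refine Finset.sum_congr rfl fun k hk => ?_
      simp only [hc', if_pos hk]
    · intro k _ hkF
      simp only [hc', if_neg hkF, norm_zero]
      ring
  rw [h1, sum_re_inner_pvGalerkinField_self κ hS hβ hβT hc'symm hc'T, toReal_eGradNormSq_realTrigPoly hS hc'symm, h2]

end Identity

/-! ## §2 Block energy along Galerkin solutions -/

section Solution

variable {S : Finset (d → ℤ)}

/-- Sums over a block `F ⊆ S` as sums over the corresponding coordinates of `S`. [folklore] -/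
private theorem sum_block_eq_sum_filter {M : Type*} [AddCommMonoid M] {F : Finset (d → ℤ)} (hFS : F ⊆ S)
    (G : (d → ℤ) → EuclideanSpace ℂ d → M) (c : ↥S → EuclideanSpace ℂ d) :
    ∑ k ∈ F, G k (coeffExt S c k) = ∑ k ∈ Finset.univ.filter (fun k : ↥S => (k : d → ℤ) ∈ F), G k (c k) := by
  classical
  have h1 : ∑ k ∈ F, G k (coeffExt S c k) = ∑ k ∈ S, if k ∈ F then G k (coeffExt S c k) else 0 := by
    rw [← Finset.sum_filter]
    congr 1
    ext k
    simp only [Finset.mem_filter]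
    exact ⟨fun hk => ⟨hFS hk, hk⟩, fun hk => hk.2⟩
  rw [h1, sum_coeffExt (fun k v => if k ∈ F then G k v else 0), Finset.sum_filter]

/-- **Block energy identity along a Galerkin solution** (differential form): if `α' = V(β, α)` within `s` at `t`,
`α t` real divergence free, `β` real divergence free, and the symmetric block `F ⊆ S` is closed under the couplings
active at time `t`, then `d/dt ∑_{k∈F} ‖α k‖² = -2κ·4π² ∑_{k∈F} |k|²‖α k‖²`. [cite: RobinsonRodrigoSadowski2016, Thm. 4.4 Step 2 (4.6)–(4.7)] -/
theorem hasDerivWithinAt_blockEnergy (κ : ℝ) (hS : ∀ k ∈ S, -k ∈ S)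
    {α : ℝ → ↥S → EuclideanSpace ℂ d} {β : ↥S → EuclideanSpace ℂ d} {s : Set ℝ} {t : ℝ}
    (h : HasDerivWithinAt α (pvGalerkinRHS S κ β (α t)) s t) (hα : α t ∈ galerkinSubspace S)
    (hβ : IsRealCoeff β) (hβT : IsSolenoidalCoeff β) {F : Finset (d → ℤ)} (hFS : F ⊆ S) (hF : ∀ k ∈ F, -k ∈ F)
    (hclosed : ∀ k ∈ F, ∀ l ∈ S, ∀ m ∈ S, l + m = k → coeffExt S β l ≠ 0 → coeffExt S (α t) m ≠ 0 → m ∈ F) :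
    HasDerivWithinAt (fun τ => ∑ k ∈ F, ‖coeffExt S (α τ) k‖ ^ 2)
      (2 * -(κ * (4 * Real.pi ^ 2 * ∑ k ∈ F, freqNormSq k * ‖coeffExt S (α t) k‖ ^ 2))) s t := by
  classical
  set F' : Finset ↥S := Finset.univ.filter (fun k : ↥S => (k : d → ℤ) ∈ F) with hF'
  have hk : ∀ k : ↥S, HasDerivWithinAt (fun τ => α τ k) (pvGalerkinRHS S κ β (α t) k) s t := fun k =>
    (ContinuousLinearMap.proj (R := ℝ) (φ := fun _ : ↥S => EuclideanSpace ℂ d) k).hasFDerivAt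
      |>.comp_hasDerivWithinAt t h
  have hsum := HasDerivWithinAt.fun_sum (u := F') fun k _ => (hk k).norm_sq
  have e1 : (fun τ => ∑ k ∈ F, ‖coeffExt S (α τ) k‖ ^ 2) = fun τ => ∑ k ∈ F', ‖α τ k‖ ^ 2 := by
    funext τ
    exact sum_block_eq_sum_filter hFS (fun _ v => ‖v‖ ^ 2) (α τ)
  rw [e1]
  refine hsum.congr_deriv ?_
  have e2 : ∑ k ∈ F', 2 * ⟪α t k, pvGalerkinRHS S κ β (α t) k⟫_ℝ =
      2 * ∑ k ∈ F, (inner ℂ (coeffExt S (α t) k)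
        (pvGalerkinField κ S (coeffExt S β) (coeffExt S (α t)) k)).re := by
    rw [Finset.mul_sum, sum_block_eq_sum_filter hFS (fun k v => 2 * (inner ℂ v
      (pvGalerkinField κ S (coeffExt S β) (coeffExt S (α t)) k)).re)]
    refine Finset.sum_congr rfl fun k _ => ?_
    rw [real_inner_eq_re_inner_euclidean]
    rfl
  rw [e2, sum_re_inner_pvGalerkinField_block κ hS (hβ.isConjSymm_coeffExt hS) hβT.isTransversal_coeffExt
    (hα.1.isConjSymm_coeffExt hS) hα.2.isTransversal_coeffExt hFS hF hclosed]

/-- **Block Poincaré**: if `α` vanishes at every `k ∈ F` with `|k|² < R²`, then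
`R² ∑_{k∈F} ‖α k‖² ≤ ∑_{k∈F} |k|² ‖α k‖²`. [cite: RobinsonRodrigoSadowski2016, Thm. 4.4 Step 2 (4.8)] -/
theorem block_poincare {c : ↥S → EuclideanSpace ℂ d} {F : Finset (d → ℤ)} {R : ℝ}
    (hR : ∀ k ∈ F, freqNormSq k < R ^ 2 → coeffExt S c k = 0) :
    R ^ 2 * ∑ k ∈ F, ‖coeffExt S c k‖ ^ 2 ≤ ∑ k ∈ F, freqNormSq k * ‖coeffExt S c k‖ ^ 2 := by
  rw [Finset.mul_sum]
  refine Finset.sum_le_sum fun k hk => ?_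
  by_cases hlt : freqNormSq k < R ^ 2
  · rw [hR k hk hlt, norm_zero]; simp
  · push Not at hlt
    exact mul_le_mul_of_nonneg_right hlt (sq_nonneg _)

/-- **Energy decay of an invariant block along a Galerkin solution** (Grönwall on `[t₀, t₁]`). Let `α` solve the
Galerkin ODE on `[t₀, t₁]` with `κ ≥ 0`, staying real divergence free, along a real divergence-free carrier curve;
let `F ⊆ S` be a symmetric block closed under the couplings active at every time of `[t₀, t₁]`, on which `α`
vanishes at every frequency with `|k|² < R²`. Then
`∑_{k∈F} ‖α t k‖² ≤ e^{-8π²κR²(t - t₀)} ∑_{k∈F} ‖α t₀ k‖²` for `t ∈ [t₀, t₁]`; with `R = 0` the block energy is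
non-increasing. [cite: RobinsonRodrigoSadowski2016, Thm. 4.4 Step 2 (4.8)] -/
theorem blockEnergy_decay_of_solution (κ : ℝ) (hκ : 0 ≤ κ) (hS : ∀ k ∈ S, -k ∈ S)
    {β : ℝ → ↥S → EuclideanSpace ℂ d} (hβr : ∀ t, IsRealCoeff (β t)) (hβT : ∀ t, IsSolenoidalCoeff (β t))
    {t₀ t₁ : ℝ} {α : ℝ → ↥S → EuclideanSpace ℂ d}
    (hα : ∀ t ∈ Icc t₀ t₁, HasDerivWithinAt α (pvGalerkinRHS S κ (β t) (α t)) (Icc t₀ t₁) t)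
    (hmem : ∀ t ∈ Icc t₀ t₁, α t ∈ galerkinSubspace S) {F : Finset (d → ℤ)} (hFS : F ⊆ S) (hF : ∀ k ∈ F, -k ∈ F)
    (hclosed : ∀ t ∈ Icc t₀ t₁, ∀ k ∈ F, ∀ l ∈ S, ∀ m ∈ S, l + m = k →
      coeffExt S (β t) l ≠ 0 → coeffExt S (α t) m ≠ 0 → m ∈ F)
    {R : ℝ} (hR : ∀ t ∈ Icc t₀ t₁, ∀ k ∈ F, freqNormSq k < R ^ 2 → coeffExt S (α t) k = 0) :
    ∀ t ∈ Icc t₀ t₁, ∑ k ∈ F, ‖coeffExt S (α t) k‖ ^ 2 ≤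
      Real.exp (-(8 * Real.pi ^ 2 * κ * R ^ 2) * (t - t₀)) * ∑ k ∈ F, ‖coeffExt S (α t₀) k‖ ^ 2 := by
  intro t ht
  set ψ : ℝ → ℝ := fun τ => ∑ k ∈ F, ‖coeffExt S (α τ) k‖ ^ 2 with hψ
  set ψ' : ℝ → ℝ := fun τ => 2 * -(κ * (4 * Real.pi ^ 2 * ∑ k ∈ F, freqNormSq k * ‖coeffExt S (α τ) k‖ ^ 2))
    with hψ'
  have hderiv : ∀ τ ∈ Icc t₀ t₁, HasDerivWithinAt ψ (ψ' τ) (Icc t₀ t₁) τ := fun τ hτ =>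
    hasDerivWithinAt_blockEnergy κ hS (hα τ hτ) (hmem τ hτ) (hβr τ) (hβT τ) hFS hF (hclosed τ hτ)
  have hcont : ContinuousOn ψ (Icc t₀ t₁) := fun τ hτ => (hderiv τ hτ).continuousWithinAt
  have hbound : ∀ τ ∈ Ico t₀ t₁, ψ' τ ≤ -(8 * Real.pi ^ 2 * κ * R ^ 2) * ψ τ + 0 := by
    intro τ hτ
    have hP := block_poincare (hR τ (Ico_subset_Icc_self hτ))
    have : ψ' τ = 2 * -(κ * (4 * Real.pi ^ 2 * ∑ k ∈ F, freqNormSq k * ‖coeffExt S (α τ) k‖ ^ 2)) := rfl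
    rw [this, add_zero]
    have : ψ τ = ∑ k ∈ F, ‖coeffExt S (α τ) k‖ ^ 2 := rfl
    rw [this]
    have h2 := mul_le_mul_of_nonneg_left (mul_le_mul_of_nonneg_left hP hκ) (by positivity : (0:ℝ) ≤ 8 * Real.pi ^ 2)
    linarith
  have hgron := le_gronwallBound_of_liminf_deriv_right_le (f := ψ) (f' := ψ') (δ := ψ t₀)
    (K := -(8 * Real.pi ^ 2 * κ * R ^ 2)) (ε := 0) (a := t₀) (b := t₁) hcont (fun τ hτ r hr => ?_) le_rfl
    hbound t ht
  · rw [gronwallBound_ε0] at hgron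
    rw [mul_comm]
    exact hgron
  · have hmem_nhds : Icc t₀ t₁ ∈ 𝓝[Ici τ] τ :=
      mem_nhdsWithin.2 ⟨Iio t₁, isOpen_Iio, hτ.2, fun z hz => ⟨hτ.1.trans hz.2, hz.1.le⟩⟩
    exact ((hderiv τ (Ico_subset_Icc_self hτ)).mono_of_mem_nhdsWithin hmem_nhds)
      |>.liminf_right_slope_le hr

/-- **Block energy is non-increasing** (the case `R = 0`). [cite: RobinsonRodrigoSadowski2016, Thm. 4.4 Step 2 (4.8)] -/
theorem blockEnergy_antitone_of_solution (κ : ℝ) (hκ : 0 ≤ κ) (hS : ∀ k ∈ S, -k ∈ S)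
    {β : ℝ → ↥S → EuclideanSpace ℂ d} (hβr : ∀ t, IsRealCoeff (β t)) (hβT : ∀ t, IsSolenoidalCoeff (β t))
    {t₀ t₁ : ℝ} {α : ℝ → ↥S → EuclideanSpace ℂ d}
    (hα : ∀ t ∈ Icc t₀ t₁, HasDerivWithinAt α (pvGalerkinRHS S κ (β t) (α t)) (Icc t₀ t₁) t)
    (hmem : ∀ t ∈ Icc t₀ t₁, α t ∈ galerkinSubspace S) {F : Finset (d → ℤ)} (hFS : F ⊆ S) (hF : ∀ k ∈ F, -k ∈ F)
    (hclosed : ∀ t ∈ Icc t₀ t₁, ∀ k ∈ F, ∀ l ∈ S, ∀ m ∈ S, l + m = k →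
      coeffExt S (β t) l ≠ 0 → coeffExt S (α t) m ≠ 0 → m ∈ F) :
    ∀ t ∈ Icc t₀ t₁, ∑ k ∈ F, ‖coeffExt S (α t) k‖ ^ 2 ≤ ∑ k ∈ F, ‖coeffExt S (α t₀) k‖ ^ 2 := by
  intro t ht
  have h := blockEnergy_decay_of_solution κ hκ hS hβr hβT hα hmem hFS hF hclosed (R := 0)
    (fun τ _ k _ hk => by
      have := freqNormSq_nonneg k
      rw [sq, zero_mul] at hk
      exact absurd hk (not_lt.2 this)) t ht
  simpa using h

end Solution

end Torus

end Literature.Analysis.FluidPDE
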